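/-
# The groups of the frame survivor `(K₁, K₂, S)` in `GL₂(𝔽_p)`, `p ≡ 3 (mod 4)`

Cell B2b-5 (`b2b-lgcu-borel`, generation 14), supporting the crux `SubgroupIdentityDesigns`
(`stmt-MatrixMultiplication-14079`) of the route `LevelGradedCohnUmans`.

HONEST FRAMING.  VALUE = THEOREM (explicit subgroups with their orders, used by
`Negative/FrameSurvivor.lean`) — NOT summit progress.  Nothing here bears on `ω`.
-/
import Summits.MatrixMultiplication.MatrixMultiplication.Theorems.SubgroupIdentityDesigns.Negative.Transvections
import Summits.MatrixMultiplication.MatrixMultiplication.Theorems.FourierTwoFamiliesModPPrimeTwoFamiliesPaleyCardNonsq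

/-!
## Contents

Three subgroups of `GL₂(𝔽_p)` for a prime `p ≡ 3 (mod 4)`, built inside the proofs (no
definitions) and exported as membership criteria + orders:
* `exists_signedUpper_subgroup`: `K₁ = {[[±1, x], [0, 1]]} = U⁺ ⋊ ⟨diag(-1,1)⟩`, `|K₁| = 2p`;
* `exists_signedLower_subgroup`: `K₂ = {[[1, 0], [y, ±1]]} = w K₁ w⁻¹`, `|K₂| = 2p`;
* `exists_sqMonomial_subgroup`: `S = {diag(a,d), antidiag(a,d) : a, d ∈ Q}` with `Q` the
  non-zero squares (`S = (Q × Q) ⋊ ⟨w⟩`), `|S| = 2 (p/2)² = (p-1)²/2`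
  (`card_nonzero_squares`: `|Q| = p/2`, from `PaleyRankBound.paley_card_nonsq`).
Helpers: `inv_mem_of_mul_mem` (a product-closed subset of a finite group containing `1` is a
subgroup), `neg_one_ne_one_of_mod_four`, `not_isSquare_neg_one_of_mod_four`.

Sorry-free; no new definitions.
-/

set_option linter.dupNamespace false

noncomputable section

open scoped BigOperators Classical
open Summit.MatrixMultiplication.MatrixMultiplication.Theorems.LieRankDesigns.Negative
  (GLm Mat budget)

namespace Summit.MatrixMultiplication.MatrixMultiplication.Theorems.SubgroupIdentityDesigns.Negative

section FrameSurvivorGroups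

open Literature.Barriers.MatrixMultiplication (SubgroupTPP)

variable {p : ℕ} [hp : Fact p.Prime]

/-- In a finite group a subset containing `1` and closed under products is closed under
inverses. -/
theorem inv_mem_of_mul_mem {G : Type*} [Group G] [Finite G] {C : Set G} (h1 : (1 : G) ∈ C)
    (hmul : ∀ a ∈ C, ∀ b ∈ C, a * b ∈ C) {g : G} (hg : g ∈ C) : g⁻¹ ∈ C := by
  have hpow : ∀ n : ℕ, g ^ n ∈ C := by
    intro n
    induction n with
    | zero => rw [pow_zero]; exact h1
    | succ n ih => rw [pow_succ]; exact hmul _ ih _ hg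
  obtain ⟨k, hk⟩ := Nat.exists_eq_succ_of_ne_zero (orderOf_pos g).ne'
  have h := pow_orderOf_eq_one g
  rw [hk, pow_succ] at h
  rw [← eq_inv_of_mul_eq_one_left h]
  exact hpow k

/-- `-1 ≠ 1` in `𝔽_p` for `p ≡ 3 (mod 4)` (so `p ≠ 2`). -/
theorem neg_one_ne_one_of_mod_four (hp4 : p % 4 = 3) : (-1 : ZMod p) ≠ 1 := by
  have h2 : ringChar (ZMod p) ≠ 2 := by
    rw [ZMod.ringChar_zmod_n]
    omega
  exact Ring.neg_one_ne_one_of_char_ne_two h2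

/-- `-1` is not a square in `𝔽_p` for `p ≡ 3 (mod 4)`. -/
theorem not_isSquare_neg_one_of_mod_four (hp4 : p % 4 = 3) : ¬ IsSquare (-1 : ZMod p) := by
  rw [ZMod.exists_sq_eq_neg_one_iff]
  exact fun h => h hp4

/-- The number of non-zero squares of `𝔽_p`, `p ≡ 3 (mod 4)`, is `(p-1)/2 = p/2`. -/
theorem card_nonzero_squares (hp4 : p % 4 = 3) :
    (Finset.univ.filter fun x : ZMod p => IsSquare x ∧ x ≠ 0).card = p / 2 := by
  have hns :=
    PrimeTwoFamilies.PaleyRankBound.paley_card_nonsq (q := p) hp4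
  have htot := Finset.card_filter_add_card_filter_not
    (s := (Finset.univ : Finset (ZMod p))) (fun x : ZMod p => IsSquare x)
  rw [Finset.card_univ, ZMod.card] at htot
  have hsplit := Finset.card_filter_add_card_filter_not
    (s := Finset.univ.filter fun x : ZMod p => IsSquare x) (fun x : ZMod p => x ≠ 0)
  rw [Finset.filter_filter, Finset.filter_filter] at hsplit
  have h0 : (Finset.univ.filter fun x : ZMod p => IsSquare x ∧ ¬ x ≠ 0) = {0} := by
    ext x
    simp only [Finset.mem_filter, Finset.mem_univ, true_and, Finset.mem_singleton, not_not]
    constructor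
    · exact fun h => h.2
    · rintro rfl
      exact ⟨IsSquare.zero, rfl⟩
  rw [h0, Finset.card_singleton] at hsplit
  omega

/-- `K₁ = {[[±1, x], [0, 1]]} = U⁺ ⋊ ⟨diag(-1, 1)⟩`, of order `2p` (`p` odd). -/
theorem exists_signedUpper_subgroup (hp4 : p % 4 = 3) :
    ∃ K : Subgroup (GLm p 2),
      (∀ g : GLm p 2, g ∈ K ↔ (g : Mat p 2) 1 0 = 0 ∧ (g : Mat p 2) 1 1 = 1 ∧
        ((g : Mat p 2) 0 0 = 1 ∨ (g : Mat p 2) 0 0 = -1)) ∧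
      Nat.card K = 2 * p := by
  obtain ⟨e00, e01, e10, e11⟩ := gl2_one_apply (p := p)
  have hm1 := neg_one_ne_one_of_mod_four hp4
  let C : Set (GLm p 2) := {g | (g : Mat p 2) 1 0 = 0 ∧ (g : Mat p 2) 1 1 = 1 ∧
    ((g : Mat p 2) 0 0 = 1 ∨ (g : Mat p 2) 0 0 = -1)}
  have hC : ∀ g : GLm p 2, g ∈ C ↔ (g : Mat p 2) 1 0 = 0 ∧ (g : Mat p 2) 1 1 = 1 ∧
      ((g : Mat p 2) 0 0 = 1 ∨ (g : Mat p 2) 0 0 = -1) := fun g => Iff.rfl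
  have h1 : (1 : GLm p 2) ∈ C := (hC 1).2 ⟨e10, e11, Or.inl e00⟩
  have hmul : ∀ a ∈ C, ∀ b ∈ C, a * b ∈ C := by
    intro a ha b hb
    rw [hC] at ha hb ⊢
    obtain ⟨ha0, ha1, ha⟩ := ha
    obtain ⟨hb0, hb1, hb⟩ := hb
    refine ⟨?_, ?_, ?_⟩
    · rw [gl2_mul_apply, ha0, ha1, hb0]; ring
    · rw [gl2_mul_apply, ha0, ha1, hb1]; ring
    · rw [gl2_mul_apply, hb0, mul_zero, add_zero]
      rcases ha with h | h <;> rcases hb with h' | h' <;> simp [h, h']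
  let K : Subgroup (GLm p 2) :=
    { carrier := C
      mul_mem' := fun ha hb => hmul _ ha _ hb
      one_mem' := h1
      inv_mem' := fun hg => inv_mem_of_mul_mem h1 hmul hg }
  have hmem : ∀ g : GLm p 2, g ∈ K ↔ (g : Mat p 2) 1 0 = 0 ∧ (g : Mat p 2) 1 1 = 1 ∧
      ((g : Mat p 2) 0 0 = 1 ∨ (g : Mat p 2) 0 0 = -1) := fun g => Iff.rfl
  refine ⟨K, hmem, ?_⟩
  let f : K → Bool × ZMod p := fun g =>
    (decide (((g : GLm p 2) : Mat p 2) 0 0 = 1), ((g : GLm p 2) : Mat p 2) 0 1)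
  have hf : Function.Bijective f := by
    constructor
    · intro g h hgh
      have hg := (hmem g).1 g.2
      have hh := (hmem h).1 h.2
      have q1 := congrArg Prod.fst hgh
      have q2 := congrArg Prod.snd hgh
      simp only [f] at q1 q2
      have e : ((g : GLm p 2) : Mat p 2) 0 0 = ((h : GLm p 2) : Mat p 2) 0 0 := by
        rcases hg.2.2 with hg1 | hg1 <;> rcases hh.2.2 with hh1 | hh1
        · rw [hg1, hh1]
        · rw [hg1, hh1, decide_eq_true rfl, decide_eq_false hm1] at q1
          exact Bool.noConfusion q1
        · rw [hg1, hh1, decide_eq_false hm1, decide_eq_true rfl] at q1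
          exact Bool.noConfusion q1
        · rw [hg1, hh1]
      exact Subtype.ext (gl2_ext e q2 (by rw [hg.1, hh.1]) (by rw [hg.2.1, hh.2.1]))
    · rintro ⟨s, b⟩
      cases s
      · obtain ⟨g, h00, h01, h10, h11⟩ := exists_gl2 (-1 : ZMod p) b 0 1
          (by rw [mul_one, mul_zero, sub_zero]; exact neg_ne_zero.2 one_ne_zero)
        refine ⟨⟨g, (hmem g).2 ⟨h10, h11, Or.inr h00⟩⟩, Prod.ext ?_ h01⟩
        simp only [f]
        rw [h00]
        exact decide_eq_false hm1
      · obtain ⟨g, h00, h01, h10, h11⟩ := exists_gl2 (1 : ZMod p) b 0 1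
          (by rw [mul_one, mul_zero, sub_zero]; exact one_ne_zero)
        refine ⟨⟨g, (hmem g).2 ⟨h10, h11, Or.inl h00⟩⟩, Prod.ext ?_ h01⟩
        simp only [f]
        rw [h00]
        exact decide_eq_true rfl
  rw [Nat.card_eq_of_bijective f hf, Nat.card_prod, Nat.card_eq_fintype_card (α := Bool),
    Fintype.card_bool, Nat.card_zmod]

/-- `K₂ = {[[1, 0], [y, ±1]]} = U⁻ ⋊ ⟨diag(1, -1)⟩ = w K₁ w⁻¹`, of order `2p` (`p` odd). -/
theorem exists_signedLower_subgroup (hp4 : p % 4 = 3) :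
    ∃ K : Subgroup (GLm p 2),
      (∀ g : GLm p 2, g ∈ K ↔ (g : Mat p 2) 0 1 = 0 ∧ (g : Mat p 2) 0 0 = 1 ∧
        ((g : Mat p 2) 1 1 = 1 ∨ (g : Mat p 2) 1 1 = -1)) ∧
      Nat.card K = 2 * p := by
  obtain ⟨K₁, hK₁, cK₁⟩ := exists_signedUpper_subgroup hp4
  obtain ⟨w, w00, w01, w10, w11⟩ := exists_gl2 (0 : ZMod p) 1 1 0
    (by rw [mul_zero, mul_one, zero_sub]; exact neg_ne_zero.2 one_ne_zero)
  refine ⟨K₁.map (MulAut.conj w⁻¹⁻¹).toMonoidHom, fun g => ?_, ?_⟩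
  · rw [mem_map_conj_inv_iff, inv_inv, hK₁]
    obtain ⟨e00, -, e10, e11⟩ := conj_w_apply w00 w01 w10 w11 g
    rw [e10, e11, e00]
  · rw [Subgroup.card_map_of_injective (MulAut.conj w⁻¹⁻¹).injective, cK₁]

/-- `S = {diag(a, d), antidiag(a, d) : a, d ∈ Q}` (`Q` = non-zero squares) `= (Q × Q) ⋊ ⟨w⟩`,
of order `2 (p/2)²` for `p ≡ 3 (mod 4)`. -/
theorem exists_sqMonomial_subgroup (hp4 : p % 4 = 3) :
    ∃ S : Subgroup (GLm p 2),
      (∀ g : GLm p 2, g ∈ S ↔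
        ((g : Mat p 2) 0 1 = 0 ∧ (g : Mat p 2) 1 0 = 0 ∧
          IsSquare ((g : Mat p 2) 0 0) ∧ IsSquare ((g : Mat p 2) 1 1)) ∨
        ((g : Mat p 2) 0 0 = 0 ∧ (g : Mat p 2) 1 1 = 0 ∧
          IsSquare ((g : Mat p 2) 0 1) ∧ IsSquare ((g : Mat p 2) 1 0))) ∧
      Nat.card S = 2 * ((p / 2) * (p / 2)) := by
  obtain ⟨e00, e01, e10, e11⟩ := gl2_one_apply (p := p)
  let C : Set (GLm p 2) := {g |
    ((g : Mat p 2) 0 1 = 0 ∧ (g : Mat p 2) 1 0 = 0 ∧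
      IsSquare ((g : Mat p 2) 0 0) ∧ IsSquare ((g : Mat p 2) 1 1)) ∨
    ((g : Mat p 2) 0 0 = 0 ∧ (g : Mat p 2) 1 1 = 0 ∧
      IsSquare ((g : Mat p 2) 0 1) ∧ IsSquare ((g : Mat p 2) 1 0))}
  have hC : ∀ g : GLm p 2, g ∈ C ↔
      ((g : Mat p 2) 0 1 = 0 ∧ (g : Mat p 2) 1 0 = 0 ∧
        IsSquare ((g : Mat p 2) 0 0) ∧ IsSquare ((g : Mat p 2) 1 1)) ∨
      ((g : Mat p 2) 0 0 = 0 ∧ (g : Mat p 2) 1 1 = 0 ∧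
        IsSquare ((g : Mat p 2) 0 1) ∧ IsSquare ((g : Mat p 2) 1 0)) := fun g => Iff.rfl
  have h1 : (1 : GLm p 2) ∈ C := (hC 1).2 (Or.inl ⟨e01, e10, by rw [e00]; exact IsSquare.one,
    by rw [e11]; exact IsSquare.one⟩)
  have hmul : ∀ a ∈ C, ∀ b ∈ C, a * b ∈ C := by
    intro a ha b hb
    rw [hC] at ha hb ⊢
    rcases ha with ⟨a01, a10, a00, a11⟩ | ⟨a00, a11, a01, a10⟩ <;>
      rcases hb with ⟨b01, b10, b00, b11⟩ | ⟨b00, b11, b01, b10⟩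
    · refine Or.inl ⟨?_, ?_, ?_, ?_⟩ <;> rw [gl2_mul_apply]
      · rw [a01, b01]; ring
      · rw [a10, b10]; ring
      · rw [a01, zero_mul, add_zero]; exact a00.mul b00
      · rw [a10, zero_mul, zero_add]; exact a11.mul b11
    · refine Or.inr ⟨?_, ?_, ?_, ?_⟩ <;> rw [gl2_mul_apply]
      · rw [b00, a01]; ring
      · rw [a10, b11]; ring
      · rw [a01, zero_mul, add_zero]; exact a00.mul b01
      · rw [a10, zero_mul, zero_add]; exact a11.mul b10
    · refine Or.inr ⟨?_, ?_, ?_, ?_⟩ <;> rw [gl2_mul_apply]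
      · rw [a00, b10]; ring
      · rw [b01, a11]; ring
      · rw [a00, zero_mul, zero_add]; exact a01.mul b11
      · rw [a11, zero_mul, add_zero]; exact a10.mul b00
    · refine Or.inl ⟨?_, ?_, ?_, ?_⟩ <;> rw [gl2_mul_apply]
      · rw [a00, b11]; ring
      · rw [b00, a11]; ring
      · rw [a00, zero_mul, zero_add]; exact a01.mul b10
      · rw [a11, zero_mul, add_zero]; exact a10.mul b01
  let S : Subgroup (GLm p 2) :=
    { carrier := C
      mul_mem' := fun ha hb => hmul _ ha _ hb
      one_mem' := h1
      inv_mem' := fun hg => inv_mem_of_mul_mem h1 hmul hg }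
  have hmem : ∀ g : GLm p 2, g ∈ S ↔ g ∈ C := fun g => Iff.rfl
  refine ⟨S, fun g => (hmem g).trans (hC g), ?_⟩
  -- the two "coordinates" of an element of `S` are non-zero squares
  have hco : ∀ g : GLm p 2, g ∈ C →
      (IsSquare ((g : Mat p 2) 0 0 + (g : Mat p 2) 0 1) ∧
        (g : Mat p 2) 0 0 + (g : Mat p 2) 0 1 ≠ 0) ∧
      (IsSquare ((g : Mat p 2) 1 1 + (g : Mat p 2) 1 0) ∧
        (g : Mat p 2) 1 1 + (g : Mat p 2) 1 0 ≠ 0) := by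
    intro g hg
    have hd := FamilyADesign.det_ne g
    rcases (hC g).1 hg with ⟨g01, g10, g00, g11⟩ | ⟨g00, g11, g01, g10⟩
    · rw [g01, g10, mul_zero, sub_zero] at hd
      rw [g01, g10, add_zero, add_zero]
      exact ⟨⟨g00, (mul_ne_zero_iff.1 hd).1⟩, ⟨g11, (mul_ne_zero_iff.1 hd).2⟩⟩
    · rw [g00, g11, zero_mul, zero_sub, neg_ne_zero] at hd
      rw [g00, g11, zero_add, zero_add]
      exact ⟨⟨g01, (mul_ne_zero_iff.1 hd).1⟩, ⟨g10, (mul_ne_zero_iff.1 hd).2⟩⟩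
  let f : S → Bool × {x : ZMod p // IsSquare x ∧ x ≠ 0} × {x : ZMod p // IsSquare x ∧ x ≠ 0} :=
    fun g => (decide (((g : GLm p 2) : Mat p 2) 0 0 = 0),
      ⟨_, (hco (g : GLm p 2) g.2).1⟩, ⟨_, (hco (g : GLm p 2) g.2).2⟩)
  have hf : Function.Bijective f := by
    constructor
    · intro g h hgh
      have hg := (hC _).1 g.2
      have hh := (hC _).1 h.2
      have hdg := FamilyADesign.det_ne (g : GLm p 2)
      have hdh := FamilyADesign.det_ne (h : GLm p 2)
      have q1 := congrArg Prod.fst hgh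
      have q2 := congrArg (fun t => ((t.2.1 : {x : ZMod p // IsSquare x ∧ x ≠ 0}) : ZMod p)) hgh
      have q3 := congrArg (fun t => ((t.2.2 : {x : ZMod p // IsSquare x ∧ x ≠ 0}) : ZMod p)) hgh
      simp only [f] at q1 q2 q3
      apply Subtype.ext
      rcases hg with ⟨g01, g10, -, -⟩ | ⟨g00, g11, -, -⟩ <;>
        rcases hh with ⟨h01, h10, -, -⟩ | ⟨h00, h11, -, -⟩
      · rw [g01, h01, add_zero, add_zero] at q2
        rw [g10, h10, add_zero, add_zero] at q3
        exact gl2_ext q2 (by rw [g01, h01]) (by rw [g10, h10]) q3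
      · exfalso
        rw [g01, g10, mul_zero, sub_zero] at hdg
        rw [decide_eq_false (mul_ne_zero_iff.1 hdg).1, h00, decide_eq_true rfl] at q1
        exact Bool.noConfusion q1
      · exfalso
        rw [h01, h10, mul_zero, sub_zero] at hdh
        rw [g00, decide_eq_true rfl, decide_eq_false (mul_ne_zero_iff.1 hdh).1] at q1
        exact Bool.noConfusion q1
      · rw [g00, h00, zero_add, zero_add] at q2
        rw [g11, h11, zero_add, zero_add] at q3
        exact gl2_ext (by rw [g00, h00]) q2 q3 (by rw [g11, h11])
    · rintro ⟨s, ⟨x, hx⟩, ⟨y, hy⟩⟩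
      cases s
      · obtain ⟨g, h00, h01, h10, h11⟩ := exists_gl2 x 0 0 y
          (by rw [mul_zero, sub_zero]; exact mul_ne_zero hx.2 hy.2)
        have hgC : g ∈ C :=
          (hC g).2 (Or.inl ⟨h01, h10, by rw [h00]; exact hx.1, by rw [h11]; exact hy.1⟩)
        refine ⟨⟨g, hgC⟩, Prod.ext ?_ (Prod.ext (Subtype.ext ?_) (Subtype.ext ?_))⟩
        · simp only [f]
          rw [h00]
          exact decide_eq_false hx.2
        · simp only [f]
          rw [h00, h01, add_zero]
        · simp only [f]
          rw [h11, h10, add_zero]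
      · obtain ⟨g, h00, h01, h10, h11⟩ := exists_gl2 0 x y 0
          (by rw [mul_zero, zero_sub, neg_ne_zero]; exact mul_ne_zero hx.2 hy.2)
        have hgC : g ∈ C :=
          (hC g).2 (Or.inr ⟨h00, h11, by rw [h01]; exact hx.1, by rw [h10]; exact hy.1⟩)
        refine ⟨⟨g, hgC⟩, Prod.ext ?_ (Prod.ext (Subtype.ext ?_) (Subtype.ext ?_))⟩
        · simp only [f]
          rw [h00]
          exact decide_eq_true rfl
        · simp only [f]
          rw [h00, h01, zero_add]
        · simp only [f]
          rw [h11, h10, zero_add]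
  have hQ : Nat.card {x : ZMod p // IsSquare x ∧ x ≠ 0} = p / 2 := by
    rw [Nat.card_eq_fintype_card, Fintype.card_subtype, card_nonzero_squares hp4]
  rw [Nat.card_eq_of_bijective f hf, Nat.card_prod, Nat.card_prod, hQ,
    Nat.card_eq_fintype_card (α := Bool), Fintype.card_bool]

end FrameSurvivorGroups

end Summit.MatrixMultiplication.MatrixMultiplication.Theorems.SubgroupIdentityDesigns.Negative
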